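import Summits.NavierStokesRegularity.FluidComputer.GateBudgetRungSucc
import Summits.NavierStokesRegularity.FluidComputer.GateBudgetPulseFine
import HarnessLib

/-!
# What no tuning can beat, part 66: THE FINE RUNG MAP — part 63 §197's rung successor map of
# the misfire ladder (20′d′) re-run on the fine pulse of part 65: the pair ledger advances by
# `0.3(δ₀ + 310 log K/K⁹) + 6/K⁹` per rung instead of `0.3(δ₀ + 1210/K⁸) + 6/K⁹`
# (law 3′, SPEC-INPUT-bp1 §BE; the drift of part 14 and the output growth kept PROPORTIONAL to
# the pulse length `T' - r ≤ 241 log K/K¹⁰` instead of part 52 §154's rounded `968/K⁸`, `242/K⁸`)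

Cell `pub-fluidc`, blueprint seat bp1 (gen 35, sixth item, file 2 of 3); same namespace and
conventions as parts 1–65 (`GateBudget*.lean`); imports part 63 (`GateBudgetRungSucc`: §196
`rung_numerics`, and through it parts 52 `knob_pulse_step`/`kept_ring`, 60 `knob_relight`, 57
`knob_cold_brackets`, 62 `ledger_slopes`/`theta_ledger_lower`/`theta_ledger_upper`/
`theta_window_step`/`pair_ledger_step`, 48 `pair_sqrt_step`, 14 `knob_phase_tracking_d`,
`refire_window_facts`, `traj_abs_le_one`) and part 65 (`GateBudgetPulseFine`: §204
`knob_pulse_exit_fine`). Headline knob family `rotorCircuit K K¹⁰ ε ρ` from (5.6) (`σ =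
ρ²e^{-K¹⁰}`; modes `0 = a`, `1 = b`, `2 = c`, `3 = d`, `4 = ã`; `P = d² + ã²`), a trigger
primitive `C` (`C' = c`), the lattice `ε = kK¹⁰ρ²` on the window `200ε/K²⁰ ≤ ρ² ≤ 2ε/K¹⁰`,
`δ₀ = kπ/((25/16 - 10⁻⁶)K¹⁰ - 1) + 1/K¹⁹`. HONEST FRAMING (verbatim): low prior, high
value-of-information experiment on Tao's machine paradigm; NOT a claim that NS blows up.
Nothing is proved about the Navier–Stokes equations.

## Why (SPEC-INPUT-bp1 §BE)

Part 52 §154 tracks the transfer mode across a pulse by part 14: `|d(T') - (sin Φ·a(r) +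
cos Φ·d(r))| ≤ 2(ε + σ + Kã(T'))(T' - r)` with the pinned angle `|Φ - kπ| ≤ δ₀`, and the output
by `ã(T') ≤ ã(r) + K(T' - r)`; it then ROUNDS both with `T' - r ≤ 242/K⁹`, `ã ≤ 1`, `ε, σ ≤ 1`
to the absolute `968/K⁸` and `242/K⁸` — the `1210/K⁸` that caps the ladder of part 64 at `N ≍
3.3·10⁻⁵K⁸`. With part 65's pulse length `τ_K = 241 log K/K¹⁰` and the sizes actually in hand
at a rung (`ε ≤ 1/K¹⁰`, `σ ≤ ε/K¹⁰`, `ã(T') ≤ ã(r) + Kτ_K ≤ 0.1415 + 241 log K/K⁹` since `ã(r)²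
≤ P(r) ≤ 1/50`) the same two facts give `√P(T') ≤ √P(r) + δ₀ + (2(ε + σ + Kã(T')) + K)τ_K ≤
√P(r) + δ₀ + 310 log K/K⁹` (§205: `(4/K¹⁰ + 1.2832K)·241 log K/K¹⁰ ≤ 310 log K/K⁹`). Nothing
else in §197 changes: the clock ledger, the cold phase (law 4″) and its pair dose `6/K⁹` are
as in part 63. The mid-pulse transfer mode is NOT small (`d ≈ ±a(r)` when `k ≥ 1`: the rotor
turns `(a, d)` by `≈ kπ`), which is why the output growth stays `K × (pulse length)` in kind.

## What is proved

* §205 `fine_allowance`: `K ≥ 16`, `0 < ε`, `ε² ≤ 1/(6K²⁰)`, `K¹⁰ρ² ≤ 2ε`, `e₀² ≤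
  1/50`, `e ≤ e₀ + Kτ_K` ⇒ `0 ≤ τ_K`, `2(ε + σ + Ke)τ_K + Kτ_K ≤ 310 log K/K⁹`, `0 ≤ 310 log
  K/K⁹ ≤ 1210/K⁸`.
* §206 `knob_pulse_step_fine`: part 52 §154's hypotheses plus `T' - r ≤ τ₀` ⇒ the pin `|Φ -
  kπ| ≤ δ` (unchanged), `|d(T')| ≤ δ|a(r)| + |d(r)| + 2(ε + σ + Kã(T'))τ₀`, `0 ≤ ã(T') ≤ ã(r) +
  Kτ₀`, `√P(T') ≤ √P(r) + (δ + (2(ε + σ + Kã(T'))τ₀ + Kτ₀))` (`δ = kπ/(ν₂K¹⁰ - 1) + 1/K¹⁹`).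
* §207 `knob_rung_succ_fine`: part 63 §197 verbatim with the pair budget / pair ledger
  increment `0.3(δ₀ + 310 log K/K⁹) + 6/K⁹`, the extra pulse fact `T' - r ≤ 241 log K/K¹⁰` and
  the output growth `ã(T') ≤ ã(r) + K·(241 log K/K¹⁰)`.

HONEST LIMITS. (i) `310 log K/K⁹` is still `K ×` the pulse length: a phase-resolved output
law (`K∫d²` over the slow climb of the trigger, where `d² ≪ 1`) would be smaller again and is
not attempted; (ii) the cold-phase dose `6/K⁹` and the clock increment `286/K⁹` per rung are
part 57's/62's absolute allowances, now comparable to the pair increment for small `k`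
(`0.3δ₀ ≈ 0.003k/K¹⁰·...`: see part 67's budget lines); (iii) every limit of parts 60–65
stands (headline family `M = K¹⁰`, `K ≥ 16`, `ε² ≤ 1/(6K²⁰)`, lattice window `k ≥ 1`,
trajectory from `delayInit`); (iv) nothing about Navier–Stokes.
[cite: Tao2016AveragedNS, §5.5 Theorem 5.3, (5.5), (5.6), (b-eq), (c-eq), (dora), (tcable)]
-/

noncomputable section

namespace Summit.NavierStokesRegularity.FluidComputer.GateBudget

open Real Set Filter Topology
open Literature.Analysis.FluidPDE.Tao2016AveragedNS

variable {K ε ρ : ℝ} {X : ℝ → Fin 5 → ℝ} {C : ℝ → ℝ}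

/-! ## §205 The fine allowance -/

/-- §205 THE FINE ALLOWANCE (numerics): `K ≥ 16`, `0 < ε`, `ε² ≤ 1/(6K²⁰)`, `K¹⁰ρ² ≤
2ε`, `e₀² ≤ 1/50`, `e ≤ e₀ + K·(241 log K/K¹⁰)` ⇒ `0 ≤ 241 log K/K¹⁰`,
`2(ε + ρ²e^{-K¹⁰} + Ke)·(241 log K/K¹⁰) + K·(241 log K/K¹⁰) ≤ 310 log K/K⁹` and `0 ≤ 310 log
K/K⁹ ≤ 1210/K⁸` (`ε ≤ 1/K¹⁰`, `σ ≤ ε/K¹⁰`, `e ≤ 0.1416`, `log K ≤ K - 1`).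
[derived: this file §205; `refire_window_facts`] -/
theorem fine_allowance (hK : 16 ≤ K) (hε : 0 < ε) (hεK : ε ^ 2 ≤ 1 / (6 * K ^ 20))
    (hhi : K ^ 10 * ρ ^ 2 ≤ 2 * ε) {e₀ e : ℝ} (he₀ : e₀ ^ 2 ≤ 1 / 50)
    (he : e ≤ e₀ + K * (241 * log K / K ^ 10)) :
    0 ≤ 241 * log K / K ^ 10 ∧
      2 * (ε + ρ ^ 2 * exp (-K ^ 10) + K * e) * (241 * log K / K ^ 10)
        + K * (241 * log K / K ^ 10) ≤ 310 * log K / K ^ 9 ∧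
      0 ≤ 310 * log K / K ^ 9 ∧ 310 * log K / K ^ 9 ≤ 1210 / K ^ 8 := by
  obtain ⟨hq1, -, -, -, -, -, -, hε1, -, -, hσ, hε12, -⟩ := refire_window_facts hK hε hεK hhi
  have hK0 : 0 < K := by linarith
  have hK8 : (0 : ℝ) < K ^ 8 := by positivity
  have hK9 : (0 : ℝ) < K ^ 9 := by positivity
  have h8 : (4294967296 : ℝ) ≤ K ^ 8 := by
    have := headline_pow_floor hK 8; norm_num at this; exact this
  have hlog0 : 0 ≤ log K := Real.log_nonneg (by linarith)
  have hlogK : log K ≤ K - 1 := Real.log_le_sub_one_of_pos hK0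
  -- `q = 1/K¹⁰`: `qK¹⁰ = 1`, `τ_K = 241 log K·q`, `1/K⁹ = Kq`, `1/K⁸ = K²q`
  obtain ⟨q, hq_def⟩ : ∃ q : ℝ, q = 1 / K ^ 10 := ⟨_, rfl⟩
  have hq0 : 0 < q := by rw [hq_def]; positivity
  have hqK : q * K ^ 10 = 1 := by rw [hq_def, one_div, inv_mul_cancel₀ (by positivity)]
  simp only [← hq_def] at hq1 hσ hε12
  have eτ : 241 * log K * q = 241 * log K / K ^ 10 := by rw [hq_def]; ring
  have e9 : 310 * log K * K * q = 310 * log K / K ^ 9 := by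
    rw [eq_div_iff hK9.ne']
    calc 310 * log K * K * q * K ^ 9 = 310 * log K * (q * K ^ 10) := by ring
      _ = 310 * log K := by rw [hqK, mul_one]
  have e8 : 1210 * K ^ 2 * q = 1210 / K ^ 8 := by
    rw [eq_div_iff hK8.ne']
    calc 1210 * K ^ 2 * q * K ^ 8 = 1210 * (q * K ^ 10) := by ring
      _ = 1210 := by rw [hqK, mul_one]
  rw [← eτ] at he
  rw [← eτ, ← e9, ← e8]
  have hεq : ε ≤ q := by
    by_contra h
    have h' := not_le.1 h
    nlinarith only [hε12, hε, hq0, mul_pos (sub_pos.2 h') (add_pos hε hq0)]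
  have hσq : ρ ^ 2 * exp (-K ^ 10) ≤ q := by nlinarith only [hσ, hε1, hq0]
  have he₀' : e₀ ≤ 283 / 2000 := by nlinarith only [he₀]
  have hτ0 : 0 ≤ 241 * log K * q := by positivity
  have hK2q : K ^ 2 * q ≤ 1 / 4294967296 := by
    rw [le_div_iff₀ (by norm_num)]
    nlinarith only [hqK, h8, mul_nonneg (mul_nonneg (sq_nonneg K) hq0.le) (sub_nonneg.2 h8)]
  have hKτ : K * (241 * log K * q) ≤ 1 / 10 ^ 7 := by
    have h1 : K * (241 * log K * q) ≤ 241 * (K ^ 2 * q) := by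
      nlinarith only [hlogK, hq0, hK0, mul_nonneg hK0.le hq0.le]
    linarith only [h1, hK2q]
  have he' : e ≤ 1416 / 10000 := by linarith only [he, he₀', hKτ]
  have hcoef : 2 * (ε + ρ ^ 2 * exp (-K ^ 10) + K * e) + K ≤ 4 * q + 12832 / 10000 * K := by
    nlinarith only [hεq, hσq, he', hK0, mul_le_mul_of_nonneg_left he' hK0.le]
  refine ⟨hτ0, ?_, by positivity, ?_⟩
  · have h1 : 2 * (ε + ρ ^ 2 * exp (-K ^ 10) + K * e) * (241 * log K * q)
        + K * (241 * log K * q)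
        = (2 * (ε + ρ ^ 2 * exp (-K ^ 10) + K * e) + K) * (241 * log K * q) := by ring
    rw [h1]
    have h2 : (2 * (ε + ρ ^ 2 * exp (-K ^ 10) + K * e) + K) * (241 * log K * q)
        ≤ (4 * q + 12832 / 10000 * K) * (241 * log K * q) :=
      mul_le_mul_of_nonneg_right hcoef hτ0
    have h3 : 0 ≤ log K * q * (1 / 2 * K - 964 * q) :=
      mul_nonneg (mul_nonneg hlog0 hq0.le) (by linarith only [hq1, hK])
    have h4 : 0 ≤ K * q * log K := mul_nonneg (mul_nonneg hK0.le hq0.le) hlog0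
    nlinarith only [h2, h3, h4]
  · have h1 : 310 * log K ≤ 1210 * K := by nlinarith only [hlogK, hK0]
    nlinarith only [mul_le_mul_of_nonneg_right h1 (mul_nonneg hK0.le hq0.le)]

/-! ## §206 The universal pulse step, fine -/

/-- §206 **THE UNIVERSAL PULSE STEP, FINE.** Part 52 §154's hypotheses verbatim (headline
family from `delayInit`, trigger primitive `C`, `K ≥ 16`, `0 < ε`, `ε² ≤ 1/(6K²⁰)`, `0 < ρ`,
`K¹⁰ρ² ≤ 2ε`, lattice `ε = kK¹⁰ρ²`, a pulse `[r, T']` with `T' - r ≤ 242/K⁹`, clocks `b(r) ≥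
θ₁ε`, `b(T') ≤ -θ₂ε`, triggers `0 < c`, `c(r) ≤ ρ²/K⁹`, `c(T') ≤ λ₀ρ²`, ring `ν₂ε²`, output
growth `ã(T') ≤ ã(r) + K(T' - r)`) plus a pulse length `T' - r ≤ τ₀` ⇒ the pin `|Φ - kπ| ≤ δ`
of §154, and — with part 14's drift and the growth kept proportional to `τ₀` — `|d(T')| ≤
δ|a(r)| + |d(r)| + 2(ε + σ + Kã(T'))τ₀`, `0 ≤ ã(T') ≤ ã(r) + Kτ₀`, `√P(T') ≤ √P(r) + (δ +
(2(ε + σ + Kã(T'))τ₀ + Kτ₀))` (`δ = kπ/(ν₂K¹⁰ - 1) + 1/K¹⁹`, part 48 `pair_sqrt_step`).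
[cite: Tao2016AveragedNS, §5.5 Theorem 5.3, (5.6), (dora), (tcable)] -/
theorem knob_pulse_step_fine
    (hX : ∀ t, HasDerivAt X (RotorKnob.rotorCircuit K (K ^ 10) ε ρ (X t)) t)
    (h0 : X 0 = delayInit) (hC : ∀ t, HasDerivAt C (X t 2) t) (hK : 16 ≤ K) (hε : 0 < ε)
    (hεK : ε ^ 2 ≤ 1 / (6 * K ^ 20)) (hρ : 0 < ρ) (hhi : K ^ 10 * ρ ^ 2 ≤ 2 * ε) (k : ℕ)
    (hk : ε = k * K ^ 10 * ρ ^ 2) {r T' θ₁ θ₂ ν₂ τ₀ : ℝ} (hr0 : 0 ≤ r) (hrT : r ≤ T')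
    (hτ : T' - r ≤ 242 / K ^ 9) (hτf : T' - r ≤ τ₀) (hθ₁ : 5 / 4 ≤ θ₁) (hθ₂ : 1 ≤ θ₂)
    (hν₂ : 1 ≤ ν₂) (hc : ∀ t ∈ Icc r T', 0 < X t 2) (hcr : X r 2 ≤ ρ ^ 2 / K ^ 9)
    (hbr : θ₁ * ε ≤ X r 1) (hbT : X T' 1 ≤ -(θ₂ * ε))
    (hcT : X T' 2 ≤ (1 / K ^ 10 + 4 * exp (-K ^ 10) / K ^ 10) * ρ ^ 2)
    (hring : ∀ t ∈ Icc r T', ν₂ * ε ^ 2 ≤ X t 1 ^ 2 + X t 2 ^ 2)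
    (hgrow : X T' 4 ≤ X r 4 + K * (T' - r)) :
    |(C T' - C r) / ρ ^ 2 - k * π| ≤ k * π / (ν₂ * K ^ 10 - 1) + 1 / K ^ 19 ∧
      |X T' 3| ≤ (k * π / (ν₂ * K ^ 10 - 1) + 1 / K ^ 19) * |X r 0| + |X r 3|
        + 2 * (ε + ρ ^ 2 * exp (-K ^ 10) + K * X T' 4) * τ₀ ∧
      0 ≤ X T' 4 ∧ X T' 4 ≤ X r 4 + K * τ₀ ∧
      √(X T' 3 ^ 2 + X T' 4 ^ 2) ≤ √(X r 3 ^ 2 + X r 4 ^ 2)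
        + ((k * π / (ν₂ * K ^ 10 - 1) + 1 / K ^ 19)
          + (2 * (ε + ρ ^ 2 * exp (-K ^ 10) + K * X T' 4) * τ₀ + K * τ₀)) := by
  have hK0 : 0 < K := by linarith
  have h10 : (1099511627776 : ℝ) ≤ K ^ 10 := by
    have := headline_pow_floor hK 10; norm_num at this; exact this
  obtain ⟨hpinS, -, heT0, -, -⟩ := knob_pulse_step hX h0 hC hK hε hεK hρ hhi k hk hr0 hrT hτ
    hθ₁ hθ₂ hν₂ hc hcr hbr hbT hcT hring hgrow
  have hXf := hX
  rw [RotorKnob.rotorCircuit_eq_fiveGate] at hXf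
  have hτ0 : 0 ≤ T' - r := by linarith only [hrT]
  have hk0 : (0 : ℝ) ≤ k := Nat.cast_nonneg k
  set δ := k * π / (ν₂ * K ^ 10 - 1) + 1 / K ^ 19 with hδ
  have hden : 0 < ν₂ * K ^ 10 - 1 := by nlinarith only [h10, hν₂]
  have hδ0 : 0 ≤ δ := by
    have : 0 ≤ k * π / (ν₂ * K ^ 10 - 1) := div_nonneg (mul_nonneg hk0 Real.pi_pos.le) hden.le
    positivity
  -- part 14's tracking of the transfer mode from `r`, drift proportional to `τ₀`
  have htd := knob_phase_tracking_d hX h0 hC hε.le hK0.le hr0 hrT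
  set Φ := (C T' - C r) / ρ ^ 2 with hΦ
  have hL0 : 0 ≤ ε + ρ ^ 2 * exp (-K ^ 10) + K * X T' 4 :=
    add_nonneg (add_nonneg hε.le (by positivity)) (mul_nonneg hK0.le heT0)
  have hdrift : 2 * ((ε + ρ ^ 2 * exp (-K ^ 10) + K * X T' 4) * (T' - r))
      ≤ 2 * (ε + ρ ^ 2 * exp (-K ^ 10) + K * X T' 4) * τ₀ := by
    nlinarith only [mul_le_mul_of_nonneg_left hτf hL0]
  -- `|sin Φ| ≤ |Φ - kπ| ≤ δ`, `|cos Φ| ≤ 1`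
  have hsin : |sin Φ| ≤ δ := by
    have hΘ : Φ = (Φ - k * π) + k * π := by ring
    rw [hΘ, sin_add_nat_mul_pi, abs_mul, abs_pow, abs_neg, abs_one, one_pow, one_mul]
    exact abs_sin_le_abs.trans hpinS
  have hd2 : |X T' 3| ≤ δ * |X r 0| + |X r 3|
      + 2 * (ε + ρ ^ 2 * exp (-K ^ 10) + K * X T' 4) * τ₀ := by
    have h1 := abs_sub_abs_le_abs_sub (X T' 3) (sin Φ * X r 0 + cos Φ * X r 3)
    have h2 := abs_add_le (sin Φ * X r 0) (cos Φ * X r 3)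
    rw [abs_mul, abs_mul] at h2
    have h3 : |sin Φ| * |X r 0| ≤ δ * |X r 0| :=
      mul_le_mul_of_nonneg_right hsin (abs_nonneg _)
    have h4 : |cos Φ| * |X r 3| ≤ |X r 3| :=
      mul_le_of_le_one_left (abs_nonneg _) (abs_cos_le_one _)
    linarith only [h1, h2, h3, h4, htd, hdrift]
  -- the output: `ã(T') ≤ ã(r) + Kτ₀`
  have heT : X T' 4 ≤ X r 4 + K * τ₀ := by
    have h1 : K * (T' - r) ≤ K * τ₀ := mul_le_mul_of_nonneg_left hτf hK0.le
    linarith only [hgrow, h1]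
  -- the ladder step (part 48 §144): `x = δ + 2(ε + σ + Kã(T'))τ₀`, `y = Kτ₀`
  have ha10 : |X r 0| ≤ 1 := traj_abs_le_one hXf h0 r 0
  have hx0 : 0 ≤ 2 * (ε + ρ ^ 2 * exp (-K ^ 10) + K * X T' 4) * τ₀ := by
    nlinarith only [hL0, hτ0.trans hτf]
  have hd2' : |X T' 3| ≤ |X r 3| + (δ + 2 * (ε + ρ ^ 2 * exp (-K ^ 10) + K * X T' 4) * τ₀) := by
    have : δ * |X r 0| ≤ δ := mul_le_of_le_one_right hδ0 ha10
    linarith only [hd2, this]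
  have hstep := pair_sqrt_step hd2' heT0 heT (by linarith only [hδ0, hx0])
    (mul_nonneg hK0.le (hτ0.trans hτf))
  exact ⟨hpinS, hd2, heT0, heT, by linarith only [hstep]⟩

/-! ## §207 The rung successor map, fine -/

/-- §207 THE RUNG SUCCESSOR MAP, FINE (the misfire ladder (20′d′) with law 3′, SPEC-INPUT-bp1
§BE). Part 63 §197 verbatim — headline member from `delayInit` with a trigger primitive `C`,
`K ≥ 16`, `0 < ε`, `ε² ≤ 1/(6K²⁰)`, `0 < ρ`, lattice window `200ε/K²⁰ ≤ ρ²`, `K¹⁰ρ² ≤ 2ε`,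
`ε = kK¹⁰ρ²`; an ignition `r ≥ 0` with `b(r) = θε`, `5/4 ≤ θ ≤ 29/20`, `c(r) = ρ²/K⁹` — but
with the pair budget `P(r) + 0.3η′ + 6/K⁹ ≤ 1/50`, `η′ = δ₀ + 310 log K/K⁹`. Then there are
`T' θ₁ tz r' θ'`: the pulse `[r, T']` (`T' - r ≤ 242/K⁹`, and `≤ 241 log K/K¹⁰`, `c > 0`,
exit clock `b(T') = -θ₁ε`, `|θ₁ - θ| ≤ 243/K⁹`, `c(T') ≤ 2ρ²/K¹⁰`, the misfire pin `|(C(T') -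
C(r))/ρ² - kπ| ≤ δ₀`, output `0 ≤ ã(T') ≤ ã(r) + K·(241 log K/K¹⁰)`), the cold phase `[T', r']`
exactly as in §197, and the ledgers at the next ignition: `b(r') = θ'ε`, `θ' ≤ 1.41422`, `θ -
286/K⁹ ≤ θ' ∨ 1.39999 ≤ θ'`, `P(r') ≤ P(r) + 0.3η′ + 6/K⁹`, `r + 1 ≤ r'`.
[derived: part 65 §204 + §206 + §205 + part 62 §195 + part 60 §186 + part 57 §172 + part 62
§192–§194, the proof of part 63 §197; Tao2016AveragedNS (5.6)] -/
theorem knob_rung_succ_fine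
    (hX : ∀ t, HasDerivAt X (RotorKnob.rotorCircuit K (K ^ 10) ε ρ (X t)) t)
    (h0 : X 0 = delayInit) {C : ℝ → ℝ} (hC : ∀ t, HasDerivAt C (X t 2) t) (hK : 16 ≤ K)
    (hε : 0 < ε) (hεK : ε ^ 2 ≤ 1 / (6 * K ^ 20)) (hρ : 0 < ρ)
    (hlo : 200 * ε / K ^ 20 ≤ ρ ^ 2) (hhi : K ^ 10 * ρ ^ 2 ≤ 2 * ε) (k : ℕ)
    (hk : ε = k * K ^ 10 * ρ ^ 2) {r θ : ℝ} (hr : 0 ≤ r) (hθ1 : 5 / 4 ≤ θ)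
    (hθ2 : θ ≤ 29 / 20) (hbr : X r 1 = θ * ε) (hcr : X r 2 = ρ ^ 2 / K ^ 9)
    (hPr : X r 3 ^ 2 + X r 4 ^ 2
      + 3 * (k * π / ((25 / 16 - 1 / 10 ^ 6) * K ^ 10 - 1) + 1 / K ^ 19
        + 310 * log K / K ^ 9) / 10 + 6 / K ^ 9 ≤ 1 / 50) :
    ∃ T' θ₁ tz r' θ' : ℝ,
      (r < T' ∧ T' - r ≤ 242 / K ^ 9 ∧ T' - r ≤ 241 * log K / K ^ 10 ∧
        (∀ t ∈ Icc r T', 0 < X t 2) ∧ X T' 1 = -(θ₁ * ε) ∧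
        θ - 243 / K ^ 9 ≤ θ₁ ∧ θ₁ ≤ θ + 243 / K ^ 9 ∧ X T' 2 ≤ 2 * ρ ^ 2 / K ^ 10 ∧
        |(C T' - C r) / ρ ^ 2 - k * π|
          ≤ k * π / ((25 / 16 - 1 / 10 ^ 6) * K ^ 10 - 1) + 1 / K ^ 19 ∧
        0 ≤ X T' 4 ∧ X T' 4 ≤ X r 4 + K * (241 * log K / K ^ 10)) ∧
      (T' + 1 ≤ tz ∧ X tz 1 = 0 ∧ tz < r' ∧ r' < T' + 3 ∧
        (∀ t ∈ Icc T' r', X t 2 ≤ ρ ^ 2 / K ^ 9) ∧ X r' 2 = ρ ^ 2 / K ^ 9) ∧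
      (X r' 1 = θ' * ε ∧ θ' ≤ 141422 / 100000 ∧
        (θ - 286 / K ^ 9 ≤ θ' ∨ 139999 / 100000 ≤ θ') ∧
        X r' 3 ^ 2 + X r' 4 ^ 2 ≤ X r 3 ^ 2 + X r 4 ^ 2
          + 3 * (k * π / ((25 / 16 - 1 / 10 ^ 6) * K ^ 10 - 1) + 1 / K ^ 19
            + 310 * log K / K ^ 9) / 10 + 6 / K ^ 9 ∧
        r + 1 ≤ r') := by
  obtain ⟨-, -, -, hδ0, hη, h243⟩ := rung_numerics hK hε hρ hlo k hk
  have hK0 : (0 : ℝ) < K := by linarith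
  have hK9 : (0 : ℝ) < K ^ 9 := by positivity
  have h6 : (0 : ℝ) ≤ 6 / K ^ 9 := by positivity
  -- (1) the fine pulse (part 65 §204)
  obtain ⟨T', θ₁, hrT, hτ, hτf, hcpos, hcT1, hcT2, hfloor, hbT, hθ₁lo, hθ₁hi, hkept, hgrow⟩ :=
    knob_pulse_exit_fine hX h0 hK hε hρ hlo hhi hr hθ1 (by linarith only [hθ2]) hbr hcr
  have hT'0 : 0 ≤ T' := by linarith only [hr, hrT]
  have hθ₁1 : 1 ≤ θ₁ := by linarith only [hθ₁lo, hθ1, h243]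
  have hθ₁2 : θ₁ ≤ 3 / 2 := by linarith only [hθ₁hi, hθ2, h243]
  -- (2) the ring (part 52 §153) and the fine pair slip (§206), uniform `ν₂ = 25/16 - 10⁻⁶`
  have hbr' : 5 / 4 * ε ≤ X r 1 := by rw [hbr]; nlinarith only [hθ1, hε]
  have hring := kept_ring hε.le (by norm_num : (0 : ℝ) ≤ 5 / 4) hbr' hkept
  have hring' : ∀ t ∈ Icc r T', (25 / 16 - 1 / 10 ^ 6) * ε ^ 2 ≤ X t 1 ^ 2 + X t 2 ^ 2 := by
    intro t ht
    have := hring t ht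
    linarith only [this]
  have hbT1 : X T' 1 ≤ -(1 * ε) := by rw [hbT]; nlinarith only [hθ₁1, hε]
  obtain ⟨hpin, -, hã0, hã, hsqrt⟩ := knob_pulse_step_fine hX h0 hC hK hε hεK hρ hhi k hk hr
    hrT.le hτ hτf (le_refl _) (le_refl _) (by norm_num) hcpos hcr.le hbr' hbT1 hcT1 hring'
    hgrow
  -- abbreviate the slip `δ₀`
  obtain ⟨δ, hδ_def⟩ :
      ∃ δ : ℝ, δ = k * π / ((25 / 16 - 1 / 10 ^ 6) * K ^ 10 - 1) + 1 / K ^ 19 := ⟨_, rfl⟩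
  simp only [← hδ_def] at hδ0 hη hPr hpin hsqrt ⊢
  -- (3) the fine allowance (§205) and the pair ledger at the dousing time (part 62 §195)
  have hPr0 : 0 ≤ X r 3 ^ 2 + X r 4 ^ 2 := by positivity
  have hP'0 : 0 ≤ X T' 3 ^ 2 + X T' 4 ^ 2 := by positivity
  have h310 : (0 : ℝ) ≤ 310 * log K / K ^ 9 :=
    div_nonneg (mul_nonneg (by norm_num) (Real.log_nonneg (by linarith only [hK]))) hK9.le
  obtain ⟨-, hF, -, h310'⟩ := fine_allowance hK hε hεK hhi (e₀ := X r 4) (e := X T' 4)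
    (by linarith only [hPr, hδ0, h6, h310, sq_nonneg (X r 3)]) hã
  have hη0 : 0 ≤ δ + 310 * log K / K ^ 9 := by linarith only [hδ0, h310]
  have hη' : δ + 310 * log K / K ^ 9 ≤ 171 / 10000 := by linarith only [hη, h310']
  have hPr50 : X r 3 ^ 2 + X r 4 ^ 2 ≤ 1 / 50 := by linarith only [hPr, hη0, h6]
  have hsqrt' : √(X T' 3 ^ 2 + X T' 4 ^ 2)
      ≤ √(X r 3 ^ 2 + X r 4 ^ 2) + (δ + 310 * log K / K ^ 9) := by
    linarith only [hsqrt, hF]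
  have hP'le : X T' 3 ^ 2 + X T' 4 ^ 2
      ≤ X r 3 ^ 2 + X r 4 ^ 2 + 3 * (δ + 310 * log K / K ^ 9) / 10 + 6 / K ^ 9 :=
    pair_ledger_step hPr0 hPr50 hη0 hη' hP'0 hsqrt' (by rw [sub_self, abs_zero]; exact h6)
  have hP'50 : X T' 3 ^ 2 + X T' 4 ^ 2 ≤ 1 / 50 := by linarith only [hP'le, hPr]
  -- abbreviate `P₀ = P(T')`
  obtain ⟨P₀, hP₀_def⟩ : ∃ P₀ : ℝ, P₀ = X T' 3 ^ 2 + X T' 4 ^ 2 := ⟨_, rfl⟩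
  simp only [← hP₀_def] at hP'0 hP'le hP'50 hsqrt'
  -- (4) the cold phase (law 4″, part 60 §186) with the floor `L = 485K`
  obtain ⟨tz, r', ⟨htz1, htz2, hbtz⟩, ⟨htzr, hr'3⟩, hcwin, hcr', hlow, ⟨hup1, hup2⟩, hclo, hchi⟩ :=
    knob_relight hX h0 hK hε hεK hρ hhi hT'0 hθ₁1 hθ₁2 hbT hP₀_def.symm hP'50 hcT2
      (by nlinarith only [hK] : (0 : ℝ) ≤ 485 * K) hfloor
  obtain ⟨hsl, -, hsu1, hsu2, -, -, -, -⟩ := ledger_slopes hK hP'0 hP'50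
  have hsu0 : 0 < 1 - P₀ + 6 / K ^ 9 := by linarith only [hsu1]
  have htz1' : T' + 1 ≤ tz := by
    have h1 : 1 ≤ θ₁ / (1 - P₀ + 6 / K ^ 9) := by
      rw [le_div_iff₀ hsu0]
      linarith only [hsu2, hθ₁lo, hθ1, h243]
    linarith only [h1, htz1]
  have hT'r' : T' ≤ r' := by linarith only [htz1', htzr]
  -- (5) the clock ledger (law 5″, part 62 §192–§194) for `x = b(r')/ε`
  obtain ⟨x, hx_def⟩ : ∃ x : ℝ, x = X r' 1 / ε := ⟨_, rfl⟩
  have hxe : X r' 1 = x * ε := by rw [hx_def]; field_simp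
  have hxlo : (1 - P₀ - 8 / K ^ 9) * (r' - tz) ≤ x := by
    rw [hx_def, le_div_iff₀ hε]
    linarith only [hclo]
  have hxhi : x ≤ (1 - P₀ + 6 / K ^ 9) * (r' - tz) := by
    rw [hx_def, div_le_iff₀ hε]
    linarith only [hchi]
  obtain ⟨hxpos, hlower⟩ := theta_ledger_lower hK hP'0 hP'50 hθ₁2 htz2 htzr hlow hxlo
  obtain ⟨-, hupper⟩ := theta_ledger_upper hK hP'0 hP'50 hθ₁1 hθ₁2
    (by nlinarith only [hK] : (0 : ℝ) ≤ 485 * K) le_rfl htz1 htzr hup1 hup2 hxpos.le hxhi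
  obtain ⟨hwin1, hwin2⟩ := theta_window_step hK hP'0 hP'50 hθ₁lo hxpos hupper hlower
  -- (6) the pair dose of the cold phase (part 57 §172) and the ledger step (part 62 §195)
  have hdose := (knob_cold_brackets hX h0 hK hε hεK hρ hhi hT'0 hr'3.le
    (by linarith only [hθ₁1]) hθ₁2 hbT hP₀_def.symm hcwin (right_mem_Icc.2 hT'r')).1
  have hdose' : |X r' 3 ^ 2 + X r' 4 ^ 2 - P₀| ≤ 6 / K ^ 9 := by
    refine le_trans hdose ?_
    rw [div_le_div_iff_of_pos_right hK9]
    linarith only [hr'3, hT'r']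
  have hP'' := pair_ledger_step hPr0 hPr50 hη0 hη' hP'0 hsqrt' hdose'
  exact ⟨T', θ₁, tz, r', x, ⟨hrT, hτ, hτf, hcpos, hbT, hθ₁lo, hθ₁hi, hcT2, hpin, hã0, hã⟩,
    ⟨htz1', hbtz, htzr, hr'3, hcwin, hcr'⟩,
    ⟨hxe, hwin1, hwin2, hP'', by linarith only [htz1', htzr, hrT]⟩⟩

end Summit.NavierStokesRegularity.FluidComputer.GateBudget

end
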